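import Literature.Probability.Percolation.TwoSeparationSets
import Summits.CriticalPhenomena.PercolationContinuityZ3.Theses.PercNearOneGluing
import HarnessLib

/-!
# `NoHeavyLowerTail` (stmt-CriticalPhenomena-4575) — pocket masses: the law of the relay set of the observer's cluster
# has a LOG-SUPERMODULAR distribution function, hence "no `M` disjoint fat pockets" (k-uniform)

Support file (lead gen 5; `--supports stmt-CriticalPhenomena-4575`).  No definitions, no named facts, no sorries.

Notation: `μ = prodBernoulli w` on `Fin n`, relays `A`, observer `o`, `π(o) = {a ∈ A : o ↔ a}`, and for `U ⊆ Fin n`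
the POCKET DISTRIBUTION FUNCTION `g(U) := P(π(o) ⊆ U) = μ{∀ a ∈ A, a ∉ U → o ↮ a}`; `g(∅ ∩ A) = P(o ↮ A) =: δ₀`
(the observer budget of the crux) and `g(U) − δ₀ = P(∅ ≠ π(o) ⊆ U)` is the POCKET MASS of the region `U`.

* `pocketDF_logSupermodular` — **`g(U₁)·g(U₂) ≤ g(U₁ ∪ U₂)·g(U₁ ∩ U₂)`**: van den Berg–Kahn 2001 Thm 1.2
  (`Literature.…VandenbergKahn2001_connectionSeparation` with `A = B = ∅`, `X = A∖U₁`, `Y = A∖U₂`).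
* `pocketDF_mul_le_of_disjoint` — for regions with `U₁ ∩ U₂ ∩ A = ∅`: `g(U₁)·g(U₂) ≤ g(U₁ ∪ U₂)·δ₀ ≤ δ₀`
  (LEAD-GEN3 §1d "no two disjoint pockets": `P(∅≠π⊆U₁)·P(∅≠π⊆U₂) ≤ δ₀`).
* `pocketDF_prod_le_of_pairwiseDisjoint` — **iterated form**: for a finite family `U : ι → Finset (Fin n)` pairwise
  disjoint on `A`,  `δ₀ · Π_{i∈s} g(U i) ≤ δ₀^{|s|} · g(⋃_{i∈s} U i)`, i.e. `Π_i (g(U_i)/δ₀) ≤ g(⋃U_i)/δ₀ ≤ 1/δ₀`: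
  with `m_i := P(∅ ≠ π(o) ⊆ U_i)` this reads `Σ_i log(1 + m_i/δ₀) ≤ log(1/δ₀)` — at most `log(1/δ₀)/log(1 + m/δ₀)`
  pairwise disjoint regions can each host pocket mass `≥ m`, and regions of mass `≤ δ₀` have total mass
  `≤ δ₀·log₂(1/δ₀)`.  This is one of the five k-uniform constraints on counterexample families of lead memo
  LEAD-GEN5 §4 (P5′); with the chain bound it gives the LAMINAR THEOREM there.
-/

noncomputable section

namespace Summit.CriticalPhenomena.PercolationContinuityZ3.Theorems

open MeasureTheory Set Literature.Probability.LatticeModels Literature.Probability.Percolation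
open scoped Classical BigOperators

variable {n : ℕ}

/-- The event `π(o) ⊆ U` written with the vertices of `A` outside `U` as the forbidden targets. [folklore] -/
theorem pocketDF_set_eq (A U : Finset (Fin n)) (o : Fin n) :
    {ω : BondConfig (Fin n) | ∀ a ∈ A, a ∉ U → ¬ (openGraph ω).Reachable o a} =
      {ω : BondConfig (Fin n) | ∀ x ∈ ((↑A : Set (Fin n)) \ ↑U), ¬ (openGraph ω).Reachable o x} := by
  ext ω
  simp only [Set.mem_setOf_eq, Set.mem_sdiff, Finset.mem_coe, and_imp]

/-- **Log-supermodularity of the pocket distribution function** `g(U) = P(π(o) ⊆ U)`: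
`g(U₁)·g(U₂) ≤ g(U₁ ∪ U₂)·g(U₁ ∩ U₂)`.
[cite: VandenbergKahn2001, Thm. 1.2 (p. 123) with `A = B = ∅`; tree `VandenbergKahn2001_connectionSeparation`] -/
theorem pocketDF_logSupermodular (w : Sym2 (Fin n) → unitInterval) (A U₁ U₂ : Finset (Fin n)) (o : Fin n) :
    (prodBernoulli w).real {ω : BondConfig (Fin n) | ∀ a ∈ A, a ∉ U₁ → ¬ (openGraph ω).Reachable o a} *
      (prodBernoulli w).real {ω : BondConfig (Fin n) | ∀ a ∈ A, a ∉ U₂ → ¬ (openGraph ω).Reachable o a} ≤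
    (prodBernoulli w).real {ω : BondConfig (Fin n) | ∀ a ∈ A, a ∉ U₁ ∪ U₂ → ¬ (openGraph ω).Reachable o a} *
      (prodBernoulli w).real {ω : BondConfig (Fin n) | ∀ a ∈ A, a ∉ U₁ ∩ U₂ → ¬ (openGraph ω).Reachable o a} := by
  have key := VandenbergKahn2001_connectionSeparation w o (∅ : Set (Fin n)) ∅
    ((↑A : Set (Fin n)) \ ↑U₁) ((↑A : Set (Fin n)) \ ↑U₂)
  have hQ : {ω : BondConfig (Fin n) | ∀ a ∈ (∅ : Set (Fin n)), (openGraph ω).Reachable o a} = Set.univ := by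
    ext ω; simp
  have hQ' : {ω : BondConfig (Fin n) | ∀ a ∈ (∅ ∪ ∅ : Set (Fin n)), (openGraph ω).Reachable o a} = Set.univ := by
    ext ω; simp
  rw [hQ, hQ', Set.inter_univ, Set.inter_univ, Set.inter_univ] at key
  have h1 : ((↑A : Set (Fin n)) \ ↑U₁) ∩ ((↑A : Set (Fin n)) \ ↑U₂) = (↑A : Set (Fin n)) \ ↑(U₁ ∪ U₂) := by
    ext x
    simp only [Set.mem_inter_iff, Set.mem_sdiff, Finset.mem_coe, Finset.mem_union, not_or]
    tauto
  have h2 : ((↑A : Set (Fin n)) \ ↑U₁) ∪ ((↑A : Set (Fin n)) \ ↑U₂) = (↑A : Set (Fin n)) \ ↑(U₁ ∩ U₂) := by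
    ext x
    simp only [Set.mem_union, Set.mem_sdiff, Finset.mem_coe, Finset.mem_inter, not_and_or]
    tauto
  rw [h1, h2] at key
  rw [pocketDF_set_eq A U₁, pocketDF_set_eq A U₂, pocketDF_set_eq A (U₁ ∪ U₂), pocketDF_set_eq A (U₁ ∩ U₂)]
  exact key

/-- If the regions `U₁`, `U₂` share no relay then `π(o) ⊆ U₁ ∩ U₂` is just `o ↮ A`:
`g(U₁ ∩ U₂) = δ₀ = P(o ↮ A)`. [folklore] -/
theorem pocketDF_inter_eq_of_disjoint (w : Sym2 (Fin n) → unitInterval) (A U₁ U₂ : Finset (Fin n)) (o : Fin n)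
    (hdisj : ∀ a ∈ A, a ∈ U₁ → a ∉ U₂) :
    (prodBernoulli w).real {ω : BondConfig (Fin n) | ∀ a ∈ A, a ∉ U₁ ∩ U₂ → ¬ (openGraph ω).Reachable o a} =
      (prodBernoulli w).real {ω : BondConfig (Fin n) | ∀ a ∈ A, ¬ (openGraph ω).Reachable o a} := by
  congr 1
  ext ω
  simp only [Set.mem_setOf_eq, Finset.mem_inter, not_and]
  constructor
  · intro h a ha
    exact h a ha (hdisj a ha)
  · intro h a ha _
    exact h a ha

/-- **No two disjoint fat pockets** (k-uniform): if `U₁`, `U₂` share no relay then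
`g(U₁)·g(U₂) ≤ g(U₁ ∪ U₂)·P(o ↮ A) ≤ P(o ↮ A)`; since `g(U) = P(o ↮ A) + P(∅ ≠ π(o) ⊆ U)`, in particular
`P(∅≠π(o)⊆U₁)·P(∅≠π(o)⊆U₂) ≤ P(o ↮ A)`.
[cite: VandenbergKahn2001, Thm. 1.2; this corollary: lead memo LEAD-GEN3 §1d] -/
theorem pocketDF_mul_le_of_disjoint (w : Sym2 (Fin n) → unitInterval) (A U₁ U₂ : Finset (Fin n)) (o : Fin n)
    (hdisj : ∀ a ∈ A, a ∈ U₁ → a ∉ U₂) :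
    (prodBernoulli w).real {ω : BondConfig (Fin n) | ∀ a ∈ A, a ∉ U₁ → ¬ (openGraph ω).Reachable o a} *
      (prodBernoulli w).real {ω : BondConfig (Fin n) | ∀ a ∈ A, a ∉ U₂ → ¬ (openGraph ω).Reachable o a} ≤
    (prodBernoulli w).real {ω : BondConfig (Fin n) | ∀ a ∈ A, a ∉ U₁ ∪ U₂ → ¬ (openGraph ω).Reachable o a} *
      (prodBernoulli w).real {ω : BondConfig (Fin n) | ∀ a ∈ A, ¬ (openGraph ω).Reachable o a} := by
  rw [← pocketDF_inter_eq_of_disjoint w A U₁ U₂ o hdisj]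
  exact pocketDF_logSupermodular w A U₁ U₂ o

/-- **No `M` disjoint fat pockets** (iterated van den Berg–Kahn, k-uniform): for a finite family of regions
`U i`, `i ∈ s`, pairwise sharing no relay,
`P(o ↮ A) · Π_{i∈s} g(U i) ≤ P(o ↮ A)^{|s|} · g(⋃_{i∈s} U i)`  (so `Π_i g(U_i)/δ₀ ≤ g(⋃ U_i)/δ₀ ≤ 1/δ₀` when
`δ₀ = P(o ↮ A) > 0`, i.e. `Σ_i log(1 + P(∅≠π(o)⊆U_i)/δ₀) ≤ log(1/δ₀)`). [this work] -/
theorem pocketDF_prod_le_of_pairwiseDisjoint {ι : Type*} (w : Sym2 (Fin n) → unitInterval) (A : Finset (Fin n))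
    (o : Fin n) (U : ι → Finset (Fin n)) (s : Finset ι)
    (hdisj : ∀ i ∈ s, ∀ j ∈ s, i ≠ j → ∀ a ∈ A, a ∈ U i → a ∉ U j) :
    (prodBernoulli w).real {ω : BondConfig (Fin n) | ∀ a ∈ A, ¬ (openGraph ω).Reachable o a} *
      ∏ i ∈ s, (prodBernoulli w).real {ω : BondConfig (Fin n) | ∀ a ∈ A, a ∉ U i → ¬ (openGraph ω).Reachable o a} ≤
    (prodBernoulli w).real {ω : BondConfig (Fin n) | ∀ a ∈ A, ¬ (openGraph ω).Reachable o a} ^ s.card *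
      (prodBernoulli w).real {ω : BondConfig (Fin n) | ∀ a ∈ A, a ∉ s.biUnion U → ¬ (openGraph ω).Reachable o a} := by
  classical
  set μ := prodBernoulli w with hμ
  set δ₀ : ℝ := μ.real {ω : BondConfig (Fin n) | ∀ a ∈ A, ¬ (openGraph ω).Reachable o a} with hδ₀
  induction s using Finset.induction_on with
  | empty =>
    have h0 : {ω : BondConfig (Fin n) | ∀ a ∈ A, a ∉ (∅ : Finset ι).biUnion U → ¬ (openGraph ω).Reachable o a} =
        {ω : BondConfig (Fin n) | ∀ a ∈ A, ¬ (openGraph ω).Reachable o a} := by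
      ext ω; simp
    rw [Finset.prod_empty, Finset.card_empty, pow_zero, mul_one, one_mul, h0]
  | insert j s hj ih =>
    have hdisj_s : ∀ i ∈ s, ∀ i' ∈ s, i ≠ i' → ∀ a ∈ A, a ∈ U i → a ∉ U i' :=
      fun i hi i' hi' hii' => hdisj i (Finset.mem_insert_of_mem hi) i' (Finset.mem_insert_of_mem hi') hii'
    have ih' := ih hdisj_s
    -- disjointness of `U j` from the union over `s`
    have hdj : ∀ a ∈ A, a ∈ U j → a ∉ s.biUnion U := by
      intro a ha haj hmem
      obtain ⟨i, hi, hai⟩ := Finset.mem_biUnion.1 hmem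
      have hij : j ≠ i := fun h => hj (h ▸ hi)
      exact hdisj j (Finset.mem_insert_self j s) i (Finset.mem_insert_of_mem hi) hij a ha haj hai
    have step := pocketDF_mul_le_of_disjoint w A (U j) (s.biUnion U) o hdj
    have hunion : U j ∪ s.biUnion U = (insert j s).biUnion U := by
      rw [Finset.biUnion_insert]
    rw [hunion] at step
    rw [Finset.prod_insert hj, Finset.card_insert_of_notMem hj, pow_succ]
    -- δ₀ * (g_j * Π_s) = g_j * (δ₀ * Π_s) ≤ g_j * (δ₀^|s| * g(⋃_s)) = δ₀^|s| * (g_j * g(⋃_s)) ≤ δ₀^|s| * (g(⋃_{s+j}) * δ₀)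
    have hgj0 : 0 ≤ μ.real {ω : BondConfig (Fin n) | ∀ a ∈ A, a ∉ U j → ¬ (openGraph ω).Reachable o a} :=
      measureReal_nonneg
    have hpow0 : 0 ≤ δ₀ ^ s.card := pow_nonneg measureReal_nonneg _
    calc δ₀ * (μ.real {ω : BondConfig (Fin n) | ∀ a ∈ A, a ∉ U j → ¬ (openGraph ω).Reachable o a} *
          ∏ i ∈ s, μ.real {ω : BondConfig (Fin n) | ∀ a ∈ A, a ∉ U i → ¬ (openGraph ω).Reachable o a})
        = μ.real {ω : BondConfig (Fin n) | ∀ a ∈ A, a ∉ U j → ¬ (openGraph ω).Reachable o a} *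
          (δ₀ * ∏ i ∈ s, μ.real {ω : BondConfig (Fin n) | ∀ a ∈ A, a ∉ U i → ¬ (openGraph ω).Reachable o a}) := by
          ring
      _ ≤ μ.real {ω : BondConfig (Fin n) | ∀ a ∈ A, a ∉ U j → ¬ (openGraph ω).Reachable o a} *
          (δ₀ ^ s.card * μ.real {ω : BondConfig (Fin n) | ∀ a ∈ A, a ∉ s.biUnion U → ¬ (openGraph ω).Reachable o a}) :=
          mul_le_mul_of_nonneg_left ih' hgj0
      _ = δ₀ ^ s.card * (μ.real {ω : BondConfig (Fin n) | ∀ a ∈ A, a ∉ U j → ¬ (openGraph ω).Reachable o a} *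
          μ.real {ω : BondConfig (Fin n) | ∀ a ∈ A, a ∉ s.biUnion U → ¬ (openGraph ω).Reachable o a}) := by ring
      _ ≤ δ₀ ^ s.card * (μ.real {ω : BondConfig (Fin n) | ∀ a ∈ A, a ∉ (insert j s).biUnion U →
            ¬ (openGraph ω).Reachable o a} * δ₀) := mul_le_mul_of_nonneg_left step hpow0
      _ = δ₀ ^ s.card * δ₀ * μ.real {ω : BondConfig (Fin n) | ∀ a ∈ A, a ∉ (insert j s).biUnion U →
            ¬ (openGraph ω).Reachable o a} := by ring




/-! ## Pocket masses: pair charging, superadditivity over disjoint regions, and the `2√δ₀` packing bound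
(lead gen 5, second instalment).  With `m(U) := P(∅ ≠ π(o) ⊆ U) = g(U) − δ₀` (the POCKET MASS of the region `U`):
* `pocket_pairCharge` / `sum_pocketEq_le_notConn` — every family of DISTINCT pockets `S_i` (values of `π(o)`) all containing a
  relay `a` and all missing a relay `a' ∈ A` has total probability `≤ P(a ↮ a')` (the events are disjoint and each separates `a`
  from `a'`); chains of nested pockets are the case used in LEAD-GEN5 §4 (P1), sunflowers through `a` the case (P4).
* `pocketMass_biUnion_ge_sum` — `m` is superadditive over pairwise relay-disjoint regions.
* `sum_pocketMass_le_of_pairwiseDisjoint` — **packing bound**: if `U_i` are pairwise relay-disjoint and each `m(U_i) ≤ B`, then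
  `Σ_i m(U_i) ≤ B + 2√δ₀` (split the family into two groups each of mass `≥ (Σ − B)/2` and apply van den Berg–Kahn to the two
  unions).  With the pair charge this gives the LAMINAR THEOREM of LEAD-GEN5 §4: laminar pocket support ⇒ `P(1 ≤ N < k/2) ≤ t + 3√δ₀`. -/

/-- **Pair charging.** If `o`'s cluster contains the relay `a` but not `a'`, then `a ↮ a'`. [folklore] -/
theorem pocket_pairCharge (w : Sym2 (Fin n) → unitInterval) (o a a' : Fin n) :
    (prodBernoulli w).real {ω : BondConfig (Fin n) | (openGraph ω).Reachable o a ∧ ¬ (openGraph ω).Reachable o a'} ≤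
      (prodBernoulli w).real {ω : BondConfig (Fin n) | ¬ (openGraph ω).Reachable a a'} := by
  refine measureReal_mono (fun ω hω => ?_) (measure_ne_top _ _)
  simp only [Set.mem_setOf_eq] at hω ⊢
  exact fun h => hω.2 (hω.1.trans h)

/-- **Chains / sunflowers of pockets are paid by ONE pair.**  For distinct relay sets `S i` (`i ∈ s`), each containing `a` and
missing `a' ∈ A`, `Σ_{i∈s} P(π(o) = S i) ≤ P(a ↮ a')`, where `π(o) = {x ∈ A : o ↔ x}`. [this work; LEAD-GEN5 §4 (P1)] -/
theorem sum_pocketEq_le_notConn {ι : Type*} (w : Sym2 (Fin n) → unitInterval) (A : Finset (Fin n)) (o a a' : Fin n)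
    (S : ι → Finset (Fin n)) (s : Finset ι) (hinj : ∀ i ∈ s, ∀ j ∈ s, S i = S j → i = j)
    (ha : ∀ i ∈ s, a ∈ S i) (ha'A : a' ∈ A) (ha' : ∀ i ∈ s, a' ∉ S i) :
    ∑ i ∈ s, (prodBernoulli w).real {ω : BondConfig (Fin n) | (A.filter fun x => ω ∈ openConn o x) = S i} ≤
      (prodBernoulli w).real {ω : BondConfig (Fin n) | ¬ (openGraph ω).Reachable a a'} := by
  classical
  have hd : Set.PairwiseDisjoint (↑s : Set ι)
      (fun i => {ω : BondConfig (Fin n) | (A.filter fun x => ω ∈ openConn o x) = S i}) := by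
    intro i hi j hj hij
    refine Set.disjoint_left.2 fun ω h1 h2 => hij (hinj i hi j hj ?_)
    simp only [Set.mem_setOf_eq] at h1 h2
    rw [← h1, ← h2]
  rw [← measureReal_biUnion_finset hd (fun i _ => MeasurableSet.of_discrete)]
  refine (measureReal_mono (fun ω hω => ?_) (measure_ne_top _ _)).trans (pocket_pairCharge w o a a')
  simp only [Set.mem_iUnion, Set.mem_setOf_eq, exists_prop] at hω ⊢
  obtain ⟨i, hi, hSi⟩ := hω
  constructor
  · have : a ∈ A.filter fun x => ω ∈ openConn o x := by rw [hSi]; exact ha i hi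
    exact (Finset.mem_filter.1 this).2
  · intro h
    have : a' ∈ A.filter fun x => ω ∈ openConn o x := Finset.mem_filter.2 ⟨ha'A, h⟩
    rw [hSi] at this
    exact ha' i hi this

/-- The pocket distribution function splits as `g(U) = P(o ↮ A) + m(U)` with `m(U) = P(∅ ≠ π(o) ⊆ U)`. [folklore] -/
theorem pocketDF_eq_add_pocketMass (w : Sym2 (Fin n) → unitInterval) (A U : Finset (Fin n)) (o : Fin n) :
    (prodBernoulli w).real {ω : BondConfig (Fin n) | ∀ a ∈ A, a ∉ U → ¬ (openGraph ω).Reachable o a} =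
      (prodBernoulli w).real {ω : BondConfig (Fin n) | ∀ a ∈ A, ¬ (openGraph ω).Reachable o a} +
      (prodBernoulli w).real {ω : BondConfig (Fin n) | (∀ a ∈ A, a ∉ U → ¬ (openGraph ω).Reachable o a) ∧
        ∃ a ∈ A, (openGraph ω).Reachable o a} := by
  have hsplit : {ω : BondConfig (Fin n) | ∀ a ∈ A, a ∉ U → ¬ (openGraph ω).Reachable o a} =
      {ω : BondConfig (Fin n) | ∀ a ∈ A, ¬ (openGraph ω).Reachable o a} ∪
      {ω : BondConfig (Fin n) | (∀ a ∈ A, a ∉ U → ¬ (openGraph ω).Reachable o a) ∧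
        ∃ a ∈ A, (openGraph ω).Reachable o a} := by
    ext ω
    simp only [Set.mem_setOf_eq, Set.mem_union]
    constructor
    · intro h
      by_cases hex : ∃ a ∈ A, (openGraph ω).Reachable o a
      · exact Or.inr ⟨h, hex⟩
      · exact Or.inl fun a ha hr => hex ⟨a, ha, hr⟩
    · rintro (h | h)
      · exact fun a ha _ => h a ha
      · exact h.1
  have hdisj : Disjoint {ω : BondConfig (Fin n) | ∀ a ∈ A, ¬ (openGraph ω).Reachable o a}
      {ω : BondConfig (Fin n) | (∀ a ∈ A, a ∉ U → ¬ (openGraph ω).Reachable o a) ∧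
        ∃ a ∈ A, (openGraph ω).Reachable o a} := by
    refine Set.disjoint_left.2 fun ω h1 h2 => ?_
    obtain ⟨a, ha, hr⟩ := h2.2
    exact h1 a ha hr
  rw [hsplit, measureReal_union hdisj MeasurableSet.of_discrete]

/-- **Superadditivity of the pocket mass over pairwise relay-disjoint regions**:
`Σ_{i∈s} m(U i) ≤ m(⋃_{i∈s} U i)`. [this work] -/
theorem pocketMass_biUnion_ge_sum {ι : Type*} (w : Sym2 (Fin n) → unitInterval) (A : Finset (Fin n)) (o : Fin n)
    (U : ι → Finset (Fin n)) (s : Finset ι)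
    (hdisj : ∀ i ∈ s, ∀ j ∈ s, i ≠ j → ∀ a ∈ A, a ∈ U i → a ∉ U j) :
    ∑ i ∈ s, (prodBernoulli w).real {ω : BondConfig (Fin n) | (∀ a ∈ A, a ∉ U i → ¬ (openGraph ω).Reachable o a) ∧
        ∃ a ∈ A, (openGraph ω).Reachable o a} ≤
      (prodBernoulli w).real {ω : BondConfig (Fin n) | (∀ a ∈ A, a ∉ s.biUnion U → ¬ (openGraph ω).Reachable o a) ∧
        ∃ a ∈ A, (openGraph ω).Reachable o a} := by
  classical
  have hd : Set.PairwiseDisjoint (↑s : Set ι) (fun i => {ω : BondConfig (Fin n) |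
      (∀ a ∈ A, a ∉ U i → ¬ (openGraph ω).Reachable o a) ∧ ∃ a ∈ A, (openGraph ω).Reachable o a}) := by
    intro i hi j hj hij
    refine Set.disjoint_left.2 fun ω h1 h2 => ?_
    simp only [Set.mem_setOf_eq] at h1 h2
    obtain ⟨a, ha, hr⟩ := h1.2
    have haUi : a ∈ U i := by
      by_contra h; exact h1.1 a ha h hr
    have haUj : a ∈ U j := by
      by_contra h; exact h2.1 a ha h hr
    exact hdisj i hi j hj hij a ha haUi haUj
  rw [← measureReal_biUnion_finset hd (fun i _ => MeasurableSet.of_discrete)]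
  refine measureReal_mono (fun ω hω => ?_) (measure_ne_top _ _)
  simp only [Set.mem_iUnion, Set.mem_setOf_eq, exists_prop] at hω ⊢
  obtain ⟨i, hi, h1, h2⟩ := hω
  refine ⟨fun a ha hnot hr => ?_, h2⟩
  have : a ∉ U i := fun h => hnot (Finset.mem_biUnion.2 ⟨i, hi, h⟩)
  exact h1 a ha this hr

/-- **Packing bound for pairwise relay-disjoint regions (k-uniform):** if each region has pocket mass `m(U i) ≤ B` (`B ≥ 0`), then
`Σ_{i∈s} m(U i) ≤ B + 2·√P(o ↮ A)`.  Proof: a sub-family `I` maximal with `Σ_I m ≤ (T+B)/2` has `Σ_I m ≥ (T−B)/2`, so both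
`⋃_I U` and `⋃_{s∖I} U` carry mass `≥ (T−B)/2`; van den Berg–Kahn for these two disjoint regions gives `((T−B)/2)² ≤ δ₀`.
[this work; LEAD-GEN5 §4 (P5) + (laminar theorem)] -/
theorem sum_pocketMass_le_of_pairwiseDisjoint {ι : Type*} (w : Sym2 (Fin n) → unitInterval) (A : Finset (Fin n)) (o : Fin n)
    (U : ι → Finset (Fin n)) (s : Finset ι) (B : ℝ) (hB0 : 0 ≤ B)
    (hdisj : ∀ i ∈ s, ∀ j ∈ s, i ≠ j → ∀ a ∈ A, a ∈ U i → a ∉ U j)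
    (hB : ∀ i ∈ s, (prodBernoulli w).real {ω : BondConfig (Fin n) | (∀ a ∈ A, a ∉ U i → ¬ (openGraph ω).Reachable o a) ∧
        ∃ a ∈ A, (openGraph ω).Reachable o a} ≤ B) :
    ∑ i ∈ s, (prodBernoulli w).real {ω : BondConfig (Fin n) | (∀ a ∈ A, a ∉ U i → ¬ (openGraph ω).Reachable o a) ∧
        ∃ a ∈ A, (openGraph ω).Reachable o a} ≤
      B + 2 * Real.sqrt ((prodBernoulli w).real {ω : BondConfig (Fin n) | ∀ a ∈ A, ¬ (openGraph ω).Reachable o a}) := by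
  classical
  set μ := prodBernoulli w with hμ
  set δ₀ : ℝ := μ.real {ω : BondConfig (Fin n) | ∀ a ∈ A, ¬ (openGraph ω).Reachable o a} with hδ₀
  -- pocket masses of the single regions
  set m : ι → ℝ := fun i => μ.real {ω : BondConfig (Fin n) | (∀ a ∈ A, a ∉ U i → ¬ (openGraph ω).Reachable o a) ∧
        ∃ a ∈ A, (openGraph ω).Reachable o a} with hm
  have hm0 : ∀ i, 0 ≤ m i := fun i => measureReal_nonneg
  set T : ℝ := ∑ i ∈ s, m i with hT
  change T ≤ B + 2 * Real.sqrt δ₀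
  have hsqrt0 : 0 ≤ Real.sqrt δ₀ := Real.sqrt_nonneg _
  by_cases hTB : T ≤ B
  · linarith
  have hTB' : B < T := lt_of_not_ge hTB
  -- a sub-family maximising its mass subject to `≤ (T+B)/2`
  set P : Finset (Finset ι) := s.powerset.filter (fun I => ∑ i ∈ I, m i ≤ (T + B) / 2) with hP
  have hPne : P.Nonempty := ⟨∅, by
    rw [hP, Finset.mem_filter]
    refine ⟨Finset.empty_mem_powerset s, ?_⟩
    simp only [Finset.sum_empty]; linarith⟩
  obtain ⟨I, hIP, hImax⟩ := Finset.exists_max_image P (fun I => ∑ i ∈ I, m i) hPne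
  rw [hP, Finset.mem_filter, Finset.mem_powerset] at hIP
  obtain ⟨hIs, hIle⟩ := hIP
  -- maximality ⇒ `Σ_I m ≥ (T - B)/2`
  have hIge : (T - B) / 2 ≤ ∑ i ∈ I, m i := by
    by_contra hlt0
    have hlt : ∑ i ∈ I, m i < (T - B) / 2 := lt_of_not_ge hlt0
    -- the complement has positive mass, hence an element of positive mass
    have hsplit : ∑ i ∈ I, m i + ∑ i ∈ s \ I, m i = T := by
      rw [hT, ← Finset.sum_union Finset.disjoint_sdiff, Finset.union_sdiff_of_subset hIs]
    have hpos : 0 < ∑ i ∈ s \ I, m i := by linarith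
    obtain ⟨j, hj, hjpos⟩ : ∃ j ∈ s \ I, (0 : ℝ) < m j := by
      apply Finset.exists_lt_of_sum_lt
      simpa using hpos
    obtain ⟨hjs, hjI⟩ := Finset.mem_sdiff.1 hj
    have hins : insert j I ∈ P := by
      rw [hP, Finset.mem_filter, Finset.mem_powerset]
      refine ⟨Finset.insert_subset hjs hIs, ?_⟩
      rw [Finset.sum_insert hjI]
      have := hB j hjs
      change m j ≤ B at this
      linarith
    have := hImax (insert j I) hins
    rw [Finset.sum_insert hjI] at this
    linarith
  -- the two groups
  set U₁ : Finset (Fin n) := I.biUnion U with hU₁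
  set U₂ : Finset (Fin n) := (s \ I).biUnion U with hU₂
  have hdisjI : ∀ i ∈ I, ∀ j ∈ I, i ≠ j → ∀ a ∈ A, a ∈ U i → a ∉ U j :=
    fun i hi j hj => hdisj i (hIs hi) j (hIs hj)
  have hdisjC : ∀ i ∈ s \ I, ∀ j ∈ s \ I, i ≠ j → ∀ a ∈ A, a ∈ U i → a ∉ U j :=
    fun i hi j hj => hdisj i (Finset.mem_sdiff.1 hi).1 j (Finset.mem_sdiff.1 hj).1
  have h12 : ∀ a ∈ A, a ∈ U₁ → a ∉ U₂ := by
    intro a ha h1 h2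
    obtain ⟨i, hi, hai⟩ := Finset.mem_biUnion.1 h1
    obtain ⟨j, hj, haj⟩ := Finset.mem_biUnion.1 h2
    obtain ⟨hjs, hjI⟩ := Finset.mem_sdiff.1 hj
    have hij : i ≠ j := fun h => hjI (h ▸ hi)
    exact hdisj i (hIs hi) j hjs hij a ha hai haj
  -- masses of the two unions
  have hM1 : (T - B) / 2 ≤ μ.real {ω : BondConfig (Fin n) | (∀ a ∈ A, a ∉ U₁ → ¬ (openGraph ω).Reachable o a) ∧
      ∃ a ∈ A, (openGraph ω).Reachable o a} :=
    hIge.trans (pocketMass_biUnion_ge_sum w A o U I hdisjI)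
  have hM2 : (T - B) / 2 ≤ μ.real {ω : BondConfig (Fin n) | (∀ a ∈ A, a ∉ U₂ → ¬ (openGraph ω).Reachable o a) ∧
      ∃ a ∈ A, (openGraph ω).Reachable o a} := by
    have hsplit : ∑ i ∈ I, m i + ∑ i ∈ s \ I, m i = T := by
      rw [hT, ← Finset.sum_union Finset.disjoint_sdiff, Finset.union_sdiff_of_subset hIs]
    have hC : (T - B) / 2 ≤ ∑ i ∈ s \ I, m i := by linarith
    exact hC.trans (pocketMass_biUnion_ge_sum w A o U (s \ I) hdisjC)
  -- van den Berg–Kahn for the two disjoint unions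
  have hvdbk := pocketDF_mul_le_of_disjoint w A U₁ U₂ o h12
  rw [pocketDF_eq_add_pocketMass w A U₁ o, pocketDF_eq_add_pocketMass w A U₂ o] at hvdbk
  have hgle : μ.real {ω : BondConfig (Fin n) | ∀ a ∈ A, a ∉ U₁ ∪ U₂ → ¬ (openGraph ω).Reachable o a} ≤ 1 :=
    measureReal_le_one
  have hδ₀0 : 0 ≤ δ₀ := measureReal_nonneg
  set x := μ.real {ω : BondConfig (Fin n) | (∀ a ∈ A, a ∉ U₁ → ¬ (openGraph ω).Reachable o a) ∧
      ∃ a ∈ A, (openGraph ω).Reachable o a} with hx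
  set y := μ.real {ω : BondConfig (Fin n) | (∀ a ∈ A, a ∉ U₂ → ¬ (openGraph ω).Reachable o a) ∧
      ∃ a ∈ A, (openGraph ω).Reachable o a} with hy
  have hx0 : 0 ≤ x := measureReal_nonneg
  have hy0 : 0 ≤ y := measureReal_nonneg
  have hTB2 : 0 ≤ (T - B) / 2 := by linarith
  -- `((T-B)/2)^2 ≤ x*y ≤ (δ₀+x)(δ₀+y) ≤ δ₀`
  have hprod : ((T - B) / 2) * ((T - B) / 2) ≤ δ₀ := by
    have h1 : ((T - B) / 2) * ((T - B) / 2) ≤ x * y := mul_le_mul hM1 hM2 hTB2 hx0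
    have h2 : x * y ≤ (δ₀ + x) * (δ₀ + y) := by nlinarith
    have h3 : (δ₀ + x) * (δ₀ + y) ≤
        μ.real {ω : BondConfig (Fin n) | ∀ a ∈ A, a ∉ U₁ ∪ U₂ → ¬ (openGraph ω).Reachable o a} * δ₀ := hvdbk
    have h4 : μ.real {ω : BondConfig (Fin n) | ∀ a ∈ A, a ∉ U₁ ∪ U₂ → ¬ (openGraph ω).Reachable o a} * δ₀ ≤ 1 * δ₀ :=
      mul_le_mul_of_nonneg_right hgle hδ₀0
    linarith
  have hle : (T - B) / 2 ≤ Real.sqrt δ₀ := by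
    rw [← Real.sqrt_mul_self hTB2]
    exact Real.sqrt_le_sqrt hprod
  linarith


/-- **Monotonicity of the pocket mass**: `m(U) ≤ m(U')` whenever every relay of `U` lies in `U'`. [folklore] -/
theorem pocketMass_mono (w : Sym2 (Fin n) → unitInterval) (A U U' : Finset (Fin n)) (o : Fin n)
    (hUU' : ∀ a ∈ A, a ∈ U → a ∈ U') :
    (prodBernoulli w).real {ω : BondConfig (Fin n) | (∀ a ∈ A, a ∉ U → ¬ (openGraph ω).Reachable o a) ∧
        ∃ a ∈ A, (openGraph ω).Reachable o a} ≤
      (prodBernoulli w).real {ω : BondConfig (Fin n) | (∀ a ∈ A, a ∉ U' → ¬ (openGraph ω).Reachable o a) ∧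
        ∃ a ∈ A, (openGraph ω).Reachable o a} := by
  refine measureReal_mono (fun ω hω => ?_) (measure_ne_top _ _)
  simp only [Set.mem_setOf_eq] at hω ⊢
  exact ⟨fun a ha haU' hr => hω.1 a ha (fun haU => haU' (hUU' a ha haU)) hr, hω.2⟩

end Summit.CriticalPhenomena.PercolationContinuityZ3.Theorems

end
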